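import Summits.BirchSwinnertonDyer.Rank1Residual.AdditivePotMult.RankOneHeegner
import HarnessLib

/-!
# Rank ONE at an additive prime, class level: the UPPER half of `BSD(E,p)` on X4 ∧ (big image) from
# the LOWER halves of the rank-zero Heegner twists — and on X4(M) ∧ (`j`-witness) from the lower
# halves of the over-`K'` inputs of the rank-zero X4(M) pairs with the same `j`

HONEST FRAMING (cell `b2b-bsdres`, run/shared/lean/b2b/bsd-rank1-residual/, verbatim in every
file): the goal of the cell is to DELETE the COMBINATION-SHAPED residual classes of the
Birch–Swinnerton-Dyer formula for ALL analytic-rank `≤ 1` elliptic curves over `ℚ` — "full BSD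
formula for every rank `≤ 1` curve in class `C`" assembled STRICTLY from published theorems — so
that the rank-`≤ 1` remainder becomes exactly the CONSTRUCTION-SHAPED classes, which are TYPED
(missing-input `Prop`s), NOT attempted. This is not "finishing BSD". Sub-cell
`b2b-bsdres-additive-p1` (CLASS-OWNERS row "X3/X4 additive — pot. multiplicative / X3♯(M)"),
generation 4; research route, no claim beyond the stated sub-classes; X4 and X4(M) REMAIN
CONSTRUCTION-SHAPED; nothing is booked.

Theorems only; no definition, no new named fact. Built on `RankOneHeegner.lean` (data level):

* §4 **`padicValNat_shaOrder_le_add_of_bad_rankOne_of_lowerTwists`**: for `W/ℚ` globally minimal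
  with `ord_{s=1} L(E,s) = 1`, a BAD prime `p ≥ 5` with `E[p]` irreducible and `ρ̄_{E,p}` onto, a
  parametrisation datum `D` at level `N_E` with `p ∤ c(D)`: IF every globally minimal model `Wd` of a
  rank-zero twist `E^{(d_K)}` by an imaginary quadratic Heegner field `K` for `N_E` satisfies the
  lower half `MissingLowerBoundAt Wd p`, THEN `#Ш(E)_an = q ∈ ℚ` with
  `ord_p #Ш(E) ≤ ord_p q + 2·ord_p ∏_ℓ c_ℓ(E)` — published binders only: Gross–Zagier `hGZ`,
  Kolyvagin `hKo`/`hB`, GZK `hGZK`, modularity `hmod`/`hnf`, Friedberg–Hoffstein `hFH` (Heegner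
  field with `|d_K| > 4`, `L(E^{(d_K)},1) ≠ 0`); Heegner datum / `K`-rational Heegner point by the
  tree theorems of Gross 1984 / Darmon 2004 Thm. 3.6; `w_K = 2`. `missingUpperBoundAt_…` on
  `p ∤ ∏c_ℓ`; `bsdp_of_bad_rankOne_of_lower_of_lowerTwists`: with the pair's OWN lower half too,
  `BSD(E,p)` — i.e. under big image, Manin and `p ∤ ∏c_ℓ`, in rank ONE at an additive prime every
  missing statement is an Eisenstein-direction (lower-bound) one, the Euler-system half being
  Kolyvagin's. (This is the additive counterpart of multr1-p2's R89.2 reading for X11b, where the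
  twist's lower half is Skinner 2016 Thm. C.)
* §5 X4(M): `ClassX4M.twist_of_heegner` (the rank-zero Heegner twist of an X4(M) pair is an X4(M)
  pair with the SAME `j`, hence the same `j`-witnesses), `missingLowerBoundAt_of_classX4M_of_jWitness_of_lowerOverC`
  (the lower half over `ℚ` of a rank-`≤ 1` X4(M) pair with a `j`-witness from the lower half of its
  over-`K'` input — gen 2's `missingLowerBoundAt_iff_overC`, Skinner 2016 Thm. C for the relocation
  twist), and **`missingUpperBoundAt_of_classX4M_rankOne_of_jWitness_of_lowerOverC`** /
  **`bsdp_of_classX4M_rankOne_of_jWitness_of_lower_of_lowerOverC`**: on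
  X4(M) ∧ (`j`-witness) ∧ `r_an = 1` ∧ `p ≥ 5` ∧ surj ∧ Manin ∧ `p ∤ ∏c_ℓ`, the UPPER half of
  `BSD(E,p)` follows from the LOWER halves of the over-`K'` inputs of the RANK-ZERO X4(M) pairs
  `(V,p)` with `j(V) = j(E)` (quadratic `K'` ramified at `p`, `V^{(d_{K'})}` `p`-multiplicative), and
  `BSD(E,p)` from these plus the pair's own lower half; `…_of_ram_of_lowerOverC`: on X4(M) ∧ (ram)
  (a multiplicative `ℓ ≠ p` of `E` with `p ∤ ord_ℓ Δ_min`; 95 ‖ 15 of the 98 ‖ 16 rank-one pairs)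
  surjectivity and the `j`-witness are automatic (`surj_of_irr_of_ram`, `exists_jWitness_of_ram`).

Reading for the map (REPORT §8): together with gen 2's one-sided rank-zero theorem (Kim 2026 upper
half), on X4(M) ∧ (`j`-witness) ∧ {`p ≥ 5`, surj, Manin, `p ∤ ∏c_ℓ`} in BOTH analytic ranks the
Euler-system halves are in hand and ONLY lower-bound (Skinner–Urban-direction) statements are
missing — over `ℚ` for the rank-one pair, over the quadratic fields `K'` ramified at `p` for the
rank-zero pairs. Census sizes are not claimed here (surjectivity and the Manin datum are per-pair
data at an additive prime). Labels UNCHANGED; nothing booked.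
-/

noncomputable section

open scoped Classical NumberField

open WeierstrassCurve NumberField Literature.NumberTheory.EllipticCurves
  Literature.NumberTheory.EllipticCurves.ModularForms
  Literature.NumberTheory.EllipticCurves.Rank1Residual
  Literature.NumberTheory.EllipticCurves.Rank1Residual.Typed
  Literature.NumberTheory.Automorphic
  IsDedekindDomain

namespace Summit.BirchSwinnertonDyer.Rank1Residual.AdditivePotMult

variable {W : WeierstrassCurve ℚ} [W.IsElliptic] {p : ℕ} [Fact p.Prime]

/-! ### §4 Class level: the twist supplied by Friedberg–Hoffstein, the Heegner point by Gross–Darmon -/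

/-- **Kolyvagin's Tamagawa defect at an ADDITIVE (or any bad) prime `p ≥ 5`, rank one, relative to
the rank-zero Heegner twists' lower halves.** Let `W/ℚ` be globally minimal with `ord_{s=1} L(E,s) = 1`,
`p ≥ 5` a prime of BAD reduction with `E[p]` irreducible and `ρ̄_{E,p}` onto (for an additive `p`
surjectivity is a genuine hypothesis — Serre's `surj_of_irr_of_ram` needs semistability), and `D` a
parametrisation datum at level `N_E` whose Manin constant is prime to `p` (a HYPOTHESIS at an
additive prime). ASSUME the lower half `MissingLowerBoundAt Wd p` for every globally minimal model
`Wd` of a rank-zero twist `E^{(d_K)}` by an imaginary quadratic `K` satisfying the Heegner hypothesis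
for `N_E`. Then `#Ш(E)_an = q ∈ ℚ` with `ord_p #Ш(E) ≤ ord_p q + 2·ord_p ∏_ℓ c_ℓ(E)`. PUBLISHED
inputs, as binders: Gross–Zagier (`hGZ`), Kolyvagin (`hKo`, `hB`), GZK over `ℚ` (`hGZK`), modularity
(`hmod`, `hnf`), Friedberg–Hoffstein (`hFH`: a Heegner field `K` with `|d_K| > 4` and
`L(E^{(d_K)},1) ≠ 0`); Heegner datum and `K`-rational Heegner point by the tree theorems
`exists_dvd_sq_sub_discr_holds`, `nonempty_heegnerDatum_holds`, `heegnerPointComplex_mem_range_map_holds`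
(Gross 1984, Darmon 2004 Thm. 3.6); `w_K = 2` from `d_K < −4`. This is multr1-p2's X11b theorem
`padicValNat_shaOrder_le_add_of_classX11b_of_ram` with Skinner 2016 Thm. C (unavailable off the
multiplicative case) replaced by the HYPOTHESIS `hlow`. Nothing booked; no label moves.
[cite: McCallumLMS1991, §1 Theorem (Kolyvagin), p. 296] [cite: JetchevSkinnerWan2017, §7.4.2 (p. 31)]
[cite: Darmon2004, Thm. 3.6 and §3.7] [cite: Miller2011LMS, Def. 1.1] -/
theorem padicValNat_shaOrder_le_add_of_bad_rankOne_of_lowerTwists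
    (hGZ : ∀ (N : ℕ) [NeZero N] (W : WeierstrassCurve ℚ) (K : Type) [Field K] [NumberField K],
      gross_zagier N W K)
    (hKo : ∀ (N : ℕ) [NeZero N] (W : WeierstrassCurve ℚ) (K : Type) [Field K] [NumberField K],
      kolyvagin N W K)
    (hB : ∀ (N : ℕ) [NeZero N] (W : WeierstrassCurve ℚ) (K : Type) [Field K] [NumberField K],
      Kolyvagin1990_padicValNat_card_sha_le N W K)
    (hGZK : rank_eq_analyticRank_of_analyticRank_le_one) (hmod : hasEntireLFunction_rat)
    (hnf : exists_isNewformOf) (hFH : friedbergHoffstein_exists_heegnerField_split_twist_ne_zero)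
    (W : WeierstrassCurve ℚ) [W.IsElliptic] [W.IsGloballyMinimal] (p : ℕ) [Fact p.Prime]
    [NeZero (W.conductorNorm ℤ)]
    (hbad : ¬ Good W p) (hirr : Irr W p) (hsurj : Surj W p) (hp5 : 5 ≤ p) (hr : W.analyticRank = 1)
    (D : ModularParametrizationData W (W.conductorNorm ℤ)) (hc : ¬ (p : ℤ) ∣ D.c)
    (hlow : ∀ (K : Type) [Field K] [NumberField K] (Wd : WeierstrassCurve ℚ) [Wd.IsElliptic]
      [Wd.IsGloballyMinimal], IsImaginaryQuadratic K →
      SatisfiesHeegnerHypothesis (W.conductorNorm ℤ) K →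
      (∃ C : VariableChange ℚ, C • W.quadraticTwist (NumberField.discr K : ℚ) = Wd) →
      Wd.analyticRank = 0 → MissingLowerBoundAt Wd p) :
    ∃ q : ℚ, shaAn W = (q : ℂ) ∧
      (padicValNat p W.shaOrder : ℤ) ≤ padicValRat p q + 2 * padicValNat p W.tamagawaProduct := by
  have hp : p.Prime := Fact.out
  have hp2 : p ≠ 2 := by omega
  have hpN : p ∣ W.conductorNorm ℤ := (W.dvd_conductorNorm_iff_not_hasGoodReductionAtPrime p).mpr hbad
  -- the sign of the functional equation is `−1` (modularity, `r_an = 1`)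
  have hw : W.rootNumber = -1 := by
    rw [WeierstrassCurve.rootNumber_eq_neg_one_pow_analyticRank_of_exists_isNewformOf hnf W, hr]
    norm_num
  -- the auxiliary field (Friedberg–Hoffstein): every `ℓ ∣ N` split, `|d_K| > 4`, `L(E^{d_K},1) ≠ 0`
  obtain ⟨K, _, _, hK, hdisc, hHN, -, hLt⟩ := hFH W hw p hp 4
  -- `w_K = 2`, prime to `p ≥ 5`
  have hμ : ¬ p ∣ Units.torsionOrder K := by
    haveI : IsTotallyComplex K := hK.2
    have hneg : NumberField.discr K < 0 := discr_neg_of_finrank_eq_two K hK.1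
    have habs : ((NumberField.discr K).natAbs : ℤ) = -NumberField.discr K :=
      Int.ofNat_natAbs_of_nonpos hneg.le
    have h4 : NumberField.discr K < -4 := by
      have : (4 : ℤ) < ((NumberField.discr K).natAbs : ℤ) := by exact_mod_cast hdisc
      omega
    rw [Literature.NumberTheory.DiophantineGeometry.torsionOrder_eq_two_of_discr_lt hK.1 h4]
    intro h2
    have := Nat.le_of_dvd two_pos h2
    omega
  -- the Heegner datum and the `K`-rational Heegner point of the given parametrisation datum `D`
  obtain ⟨β, hβ⟩ := exists_dvd_sq_sub_discr_holds (W.conductorNorm ℤ) K hK hHN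
  obtain ⟨H, -⟩ := nonempty_heegnerDatum_holds (W.conductorNorm ℤ) K hK hβ
  obtain ⟨ι⟩ : Nonempty (K →+* ℂ) := inferInstance
  obtain ⟨P, hP⟩ := heegnerPointComplex_mem_range_map_holds (W.conductorNorm ℤ) W K hK hHN D H ι
  -- a globally minimal model of the twist
  have hD0 : (NumberField.discr K : ℚ) ≠ 0 := by exact_mod_cast NumberField.discr_ne_zero K
  haveI hEt : (W.quadraticTwist (NumberField.discr K : ℚ)).IsElliptic :=
    W.isElliptic_quadraticTwist hD0
  obtain ⟨Cd, hCd⟩ := hasGlobalMinimalModel_rat_holds (W.quadraticTwist (NumberField.discr K : ℚ))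
  haveI : (Cd • W.quadraticTwist (NumberField.discr K : ℚ)).IsGloballyMinimal := hCd
  have hWd : Cd • W.quadraticTwist (NumberField.discr K : ℚ) =
      Cd • W.quadraticTwist (NumberField.discr K : ℚ) := rfl
  -- the twist has analytic rank `0`
  have hrd : (Cd • W.quadraticTwist (NumberField.discr K : ℚ)).analyticRank = 0 := by
    rw [analyticRank_smul]
    exact analyticRank_eq_zero_of_entireLFunction_one_ne_zero _ hLt
  have hlowd := hlow K (Cd • W.quadraticTwist (NumberField.discr K : ℚ)) hK hHN ⟨Cd, rfl⟩ hrd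
  exact padicValNat_shaOrder_le_add_of_heegnerData_of_lowerTwist W p K D H ι P (hGZ _ W K)
    (hKo _ W K) hGZK hmod hr hp5 hpN hirr hK hHN hP hc hμ hLt
    (Cd • W.quadraticTwist (NumberField.discr K : ℚ)) Cd hWd hlowd
    (fun _ hnt ↦ hB _ W K hK hHN ⟨D, H, ι, hP⟩ hnt hp hp2 hsurj)

/-- **The upper half on `p ∤ ∏ c_ℓ`** (same hypotheses): `Typed.MissingUpperBoundAt W p`
(`ord_p #Ш(E) ≤ ord_p #Ш(E)_an`). [cite: McCallumLMS1991, §1 Theorem (Kolyvagin), p. 296]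
[cite: Miller2011LMS, Def. 1.1] -/
theorem missingUpperBoundAt_of_bad_rankOne_of_lowerTwists
    (hGZ : ∀ (N : ℕ) [NeZero N] (W : WeierstrassCurve ℚ) (K : Type) [Field K] [NumberField K],
      gross_zagier N W K)
    (hKo : ∀ (N : ℕ) [NeZero N] (W : WeierstrassCurve ℚ) (K : Type) [Field K] [NumberField K],
      kolyvagin N W K)
    (hB : ∀ (N : ℕ) [NeZero N] (W : WeierstrassCurve ℚ) (K : Type) [Field K] [NumberField K],
      Kolyvagin1990_padicValNat_card_sha_le N W K)
    (hGZK : rank_eq_analyticRank_of_analyticRank_le_one) (hmod : hasEntireLFunction_rat)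
    (hnf : exists_isNewformOf) (hFH : friedbergHoffstein_exists_heegnerField_split_twist_ne_zero)
    (W : WeierstrassCurve ℚ) [W.IsElliptic] [W.IsGloballyMinimal] (p : ℕ) [Fact p.Prime]
    [NeZero (W.conductorNorm ℤ)]
    (hbad : ¬ Good W p) (hirr : Irr W p) (hsurj : Surj W p) (hp5 : 5 ≤ p) (hr : W.analyticRank = 1)
    (D : ModularParametrizationData W (W.conductorNorm ℤ)) (hc : ¬ (p : ℤ) ∣ D.c)
    (htam : ¬ p ∣ W.tamagawaProduct)
    (hlow : ∀ (K : Type) [Field K] [NumberField K] (Wd : WeierstrassCurve ℚ) [Wd.IsElliptic]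
      [Wd.IsGloballyMinimal], IsImaginaryQuadratic K →
      SatisfiesHeegnerHypothesis (W.conductorNorm ℤ) K →
      (∃ C : VariableChange ℚ, C • W.quadraticTwist (NumberField.discr K : ℚ) = Wd) →
      Wd.analyticRank = 0 → MissingLowerBoundAt Wd p) :
    MissingUpperBoundAt W p := by
  obtain ⟨q, hq, hle⟩ := padicValNat_shaOrder_le_add_of_bad_rankOne_of_lowerTwists hGZ hKo hB hGZK
    hmod hnf hFH W p hbad hirr hsurj hp5 hr D hc hlow
  refine ⟨q, hq, ?_⟩
  rw [padicValNat.eq_zero_of_not_dvd htam, Nat.cast_zero, mul_zero, add_zero] at hle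
  exact hle

/-- **`BSD(E,p)` in rank one at a bad prime from LOWER halves only** (same hypotheses, plus the
lower half `MissingLowerBoundAt W p` for `E` itself): under big image, Manin and `p ∤ ∏c_ℓ`, the
Euler-system half is Kolyvagin's and every missing statement is an Eisenstein-direction one.
[cite: Miller2011LMS, Def. 1.1] -/
theorem bsdp_of_bad_rankOne_of_lower_of_lowerTwists
    (hGZ : ∀ (N : ℕ) [NeZero N] (W : WeierstrassCurve ℚ) (K : Type) [Field K] [NumberField K],
      gross_zagier N W K)
    (hKo : ∀ (N : ℕ) [NeZero N] (W : WeierstrassCurve ℚ) (K : Type) [Field K] [NumberField K],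
      kolyvagin N W K)
    (hB : ∀ (N : ℕ) [NeZero N] (W : WeierstrassCurve ℚ) (K : Type) [Field K] [NumberField K],
      Kolyvagin1990_padicValNat_card_sha_le N W K)
    (hGZK : rank_eq_analyticRank_of_analyticRank_le_one) (hmod : hasEntireLFunction_rat)
    (hnf : exists_isNewformOf) (hFH : friedbergHoffstein_exists_heegnerField_split_twist_ne_zero)
    (W : WeierstrassCurve ℚ) [W.IsElliptic] [W.IsGloballyMinimal] (p : ℕ) [Fact p.Prime]
    [NeZero (W.conductorNorm ℤ)]
    (hbad : ¬ Good W p) (hirr : Irr W p) (hsurj : Surj W p) (hp5 : 5 ≤ p) (hr : W.analyticRank = 1)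
    (D : ModularParametrizationData W (W.conductorNorm ℤ)) (hc : ¬ (p : ℤ) ∣ D.c)
    (htam : ¬ p ∣ W.tamagawaProduct) (hlowW : MissingLowerBoundAt W p)
    (hlow : ∀ (K : Type) [Field K] [NumberField K] (Wd : WeierstrassCurve ℚ) [Wd.IsElliptic]
      [Wd.IsGloballyMinimal], IsImaginaryQuadratic K →
      SatisfiesHeegnerHypothesis (W.conductorNorm ℤ) K →
      (∃ C : VariableChange ℚ, C • W.quadraticTwist (NumberField.discr K : ℚ) = Wd) →
      Wd.analyticRank = 0 → MissingLowerBoundAt Wd p) :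
    BSDp W p :=
  bsdp_of_missingPPartAt W p hGZK (by rw [hr])
    (missingPPartAt_of_lower_of_upper W p hlowW
      (missingUpperBoundAt_of_bad_rankOne_of_lowerTwists hGZ hKo hB hGZK hmod hnf hFH W p hbad hirr
        hsurj hp5 hr D hc htam hlow))

/-! ### §5 X4(M): the Heegner twist is an X4(M) pair with the same `j`; its lower half from the
### over-`K'` input of ITS relocation; the rank-one upper half of this sub-cell -/

/-- **The rank-zero Heegner twist of an X4(M) pair is an X4(M) pair with the same `j`-invariant.**
For `(E,p) ∈ X4(M)` and an imaginary quadratic `K` with the Heegner hypothesis for `N_E` (so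
`d_K ∈ ℚ_p^{×2}`): every model `Wd` of `E^{(d_K)}` has `ClassX4M Wd p` and `j(Wd) = j(E)` (additive
and multiplicative reduction transport along a `p`-adic square twist — `addv_iff_of_twist` —,
irreducibility by x11b's transport, `ord_p j` by `j`). [folklore] -/
theorem ClassX4M.twist_of_heegner [W.IsGloballyMinimal] (hX : ClassX4M W p)
    (K : Type) [Field K] [NumberField K] (hK : IsImaginaryQuadratic K)
    (hHN : SatisfiesHeegnerHypothesis (W.conductorNorm ℤ) K)
    (Wd : WeierstrassCurve ℚ) [Wd.IsElliptic]
    (hWd : ∃ C : VariableChange ℚ, C • W.quadraticTwist (NumberField.discr K : ℚ) = Wd) :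
    ClassX4M Wd p ∧ Wd.j = W.j := by
  have hD0 : (NumberField.discr K : ℚ) ≠ 0 := by exact_mod_cast NumberField.discr_ne_zero K
  have hpN : p ∣ W.conductorNorm ℤ :=
    (W.dvd_conductorNorm_iff_not_hasGoodReductionAtPrime p).mpr hX.1.2.1.1
  have hsq' : IsSquare (algebraMap ℚ ℚ_[p] (NumberField.discr K : ℚ)) :=
    X11b.isSquare_discr_padic_of_heegner K hK hHN p hpN
  have hsq : IsSquare (((NumberField.discr K : ℚ) : ℚ) : ℚ_[p]) := by simpa using hsq'
  obtain ⟨C, hC⟩ := hWd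
  have hj : Wd.j = W.j := j_of_model_twist hD0 ⟨C, hC⟩
  have haddv : Addv Wd p := (addv_iff_of_twist hD0 hsq Wd hC).mpr hX.1.2.1
  have hirr : Irr Wd p := X11b.hasIrreducibleModPGaloisRep_twist_model W p K hK.1 hX.irr C hC
  refine ⟨⟨⟨hX.p_ne_two, haddv, hirr⟩, haddv, ?_⟩, hj⟩
  rw [hj]; exact hX.potMult.2

/-- **The lower half over `ℚ` of a rank-`≤ 1` X4(M) pair with a `j`-witness FROM the lower half of
its over-`K'` input** (`K'` the relocation field of `TwistSupplyJ`; Skinner 2016 Thm. C closes the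
rank-zero (ram) `p`-multiplicative twist; gen 2's `missingLowerBoundAt_iff_overC`, Milne any-model
`hMilneC`). [folklore] -/
theorem missingLowerBoundAt_of_classX4M_of_jWitness_of_lowerOverC [W.IsGloballyMinimal]
    (hGZK : rank_eq_analyticRank_of_analyticRank_le_one) (hmod : hasEntireLFunction_rat)
    (hMilneC : Milne1972.bsdQuotient_baseChange_quadratic_anyModel)
    (hSk : Skinner2016.thmC_padicValRat_bsd_rank_zero)
    (hnf : exists_isNewformOf) (hHL : HoffsteinLuo1997_exists_twist_L_one_ne_zero)
    (hX : ClassX4M W p) (hr : W.analyticRank ≤ 1) {q : ℕ} (hq : q.Prime) (hqp : q ≠ p)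
    (hjq : padicValRat q W.j < 0) (hpj : ¬ (p : ℤ) ∣ padicValRat q W.j)
    (hK : ∀ (K : Type) [Field K] [NumberField K] (Wd : WeierstrassCurve ℚ) [Wd.IsElliptic]
      [Wd.IsGloballyMinimal], Module.finrank ℚ K = 2 →
      (∃ C : VariableChange ℚ, C • W.quadraticTwist (NumberField.discr K : ℚ) = Wd) →
      Mult Wd p → MissingLowerBoundOverCAt (W.baseChange K) p) :
    MissingLowerBoundAt W p := by
  obtain ⟨K, iF, iN, Wd, iWd, iWdm, h2, hWd, hmult, hirrd, hram, hr0⟩ :=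
    hX.exists_ram_rankZero_mult_twist_of_jWitness hq hqp hjq hpj hnf hHL
  haveI : (W.baseChange K).IsElliptic := by rw [baseChange]; infer_instance
  have hV : ∃ C : VariableChange K, C • W.baseChange K = W.baseChange K := ⟨1, one_smul _ _⟩
  have hd : BSDp Wd p := bsdp_twist_of_rankZero_ram p Wd hSk hGZK hmod hX.p_ne_two hmult hirrd hram hr0
  obtain ⟨-, hfinW⟩ := hGZK W hr
  obtain ⟨-, hfinD⟩ := hGZK Wd (by rw [hr0]; exact zero_le_one)
  obtain ⟨hshaK, hWR⟩ := hMilneC W K h2 Wd hWd (W.baseChange K) hV hfinW hfinD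
  exact (missingLowerBoundAt_iff_overC W p K Wd (W.baseChange K) hmod h2 hWd hV hfinW hfinD hshaK hWR
    hd).mpr (hK K Wd h2 hWd hmult)

/-- **X4(M) ∧ (`j`-witness), RANK ONE, `p ≥ 5`, `ρ̄_{E,p}` onto, Manin, `p ∤ ∏ c_ℓ(E)`: the UPPER half
of `BSD(E,p)` from the LOWER halves of the over-`K'` inputs of the RANK-ZERO X4(M) pairs with the same
`j`-invariant.** Precisely: let `(E,p) ∈ X4(M)` (`W` globally minimal) have `ord_{s=1} L(E,s) = 1`,
a `j`-witness `q`, `p ≥ 5`, `ρ̄_{E,p}` surjective, a parametrisation datum `D` with `p ∤ c(D)`, and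
`p ∤ ∏ c_ℓ(E)`; assume, for every X4(M) pair `(V,p)` with `j(V) = j(E)` and `ord_{s=1} L(V,s) = 0`,
the lower half `MissingLowerBoundOverCAt (V.baseChange K') p` over every quadratic `K'` whose twist
`V^{(d_{K'})}` is `p`-multiplicative. Then `Typed.MissingUpperBoundAt W p`. All other inputs are
published (Gross–Zagier, Kolyvagin, GZK, modularity, Friedberg–Hoffstein, Milne 1972, Skinner 2016
Thm. C, Hoffstein–Luo 1997). So on this sub-population the Euler-system half in rank ONE costs no
new statement: the Kato/Kim half in rank `0` (additive-p4's `X4RankZero`, gen 2's `OneSided.lean`)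
and Kolyvagin's half in rank `1` leave ONLY Eisenstein-direction (lower-bound) statements over the
quadratic fields `K'` ramified at `p` as the missing input. X4(M) stays CONSTRUCTION-SHAPED; nothing
booked. [cite: McCallumLMS1991, §1 Theorem (Kolyvagin), p. 296] [cite: Miller2011LMS, Def. 1.1] -/
theorem missingUpperBoundAt_of_classX4M_rankOne_of_jWitness_of_lowerOverC [W.IsGloballyMinimal]
    (hGZ : ∀ (N : ℕ) [NeZero N] (W : WeierstrassCurve ℚ) (K : Type) [Field K] [NumberField K],
      gross_zagier N W K)
    (hKo : ∀ (N : ℕ) [NeZero N] (W : WeierstrassCurve ℚ) (K : Type) [Field K] [NumberField K],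
      kolyvagin N W K)
    (hB : ∀ (N : ℕ) [NeZero N] (W : WeierstrassCurve ℚ) (K : Type) [Field K] [NumberField K],
      Kolyvagin1990_padicValNat_card_sha_le N W K)
    (hGZK : rank_eq_analyticRank_of_analyticRank_le_one) (hmod : hasEntireLFunction_rat)
    (hnf : exists_isNewformOf) (hFH : friedbergHoffstein_exists_heegnerField_split_twist_ne_zero)
    (hMilneC : Milne1972.bsdQuotient_baseChange_quadratic_anyModel)
    (hSk : Skinner2016.thmC_padicValRat_bsd_rank_zero)
    (hHL : HoffsteinLuo1997_exists_twist_L_one_ne_zero)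
    [NeZero (W.conductorNorm ℤ)]
    (hX : ClassX4M W p) (hr : W.analyticRank = 1) (hsurj : Surj W p) (hp5 : 5 ≤ p)
    {q : ℕ} (hq : q.Prime) (hqp : q ≠ p) (hjq : padicValRat q W.j < 0)
    (hpj : ¬ (p : ℤ) ∣ padicValRat q W.j)
    (D : ModularParametrizationData W (W.conductorNorm ℤ)) (hc : ¬ (p : ℤ) ∣ D.c)
    (htam : ¬ p ∣ W.tamagawaProduct)
    (hlowK : ∀ (V : WeierstrassCurve ℚ) [V.IsElliptic] [V.IsGloballyMinimal], ClassX4M V p →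
      V.j = W.j → V.analyticRank = 0 →
      ∀ (K : Type) [Field K] [NumberField K] (Vd : WeierstrassCurve ℚ) [Vd.IsElliptic]
        [Vd.IsGloballyMinimal], Module.finrank ℚ K = 2 →
        (∃ C : VariableChange ℚ, C • V.quadraticTwist (NumberField.discr K : ℚ) = Vd) →
        Mult Vd p → MissingLowerBoundOverCAt (V.baseChange K) p) :
    MissingUpperBoundAt W p := by
  refine missingUpperBoundAt_of_bad_rankOne_of_lowerTwists hGZ hKo hB hGZK hmod hnf hFH W p
    hX.1.2.1.1 hX.irr hsurj hp5 hr D hc htam fun K _ _ Wd _ _ hK hHN hWd hrd ↦ ?_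
  obtain ⟨hXd, hj⟩ := hX.twist_of_heegner K hK hHN Wd hWd
  have hjq' : padicValRat q Wd.j < 0 := by rw [hj]; exact hjq
  have hpj' : ¬ (p : ℤ) ∣ padicValRat q Wd.j := by rw [hj]; exact hpj
  exact missingLowerBoundAt_of_classX4M_of_jWitness_of_lowerOverC hGZK hmod hMilneC hSk hnf hHL hXd
    (by rw [hrd]; exact zero_le_one) hq hqp hjq' hpj' (hlowK Wd hXd hj hrd)

/-- **X4(M) ∧ (ram) ∧ RANK ONE — no surjectivity hypothesis, no `j`-witness hypothesis**: if `E`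
itself has a multiplicative prime `ℓ ≠ p` with `p ∤ ord_ℓ Δ_min(E)` (`Ram W p`; 95 ‖ 15 of the
98 ‖ 16 rank-one X4(M) census pairs), then `ρ̄_{E,p}` is onto (`surj_of_irr_of_ram`, Serre 1972
Prop. 15 + the Tate curve at `ℓ`, ANY reduction at `p`) and `ℓ` is a `j`-witness
(`exists_jWitness_of_ram`); so with `p ≥ 5`, a Manin-unit datum and `p ∤ ∏ c_ℓ(E)`, the UPPER half
of `BSD(E,p)` follows from the rank-zero lower halves over the fields `K'` as in
`missingUpperBoundAt_of_classX4M_rankOne_of_jWitness_of_lowerOverC` (and `BSD(E,p)` from these plus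
the pair's own lower half, by `missingPPartAt_of_lower_of_upper`). [folklore] -/
theorem missingUpperBoundAt_of_classX4M_rankOne_of_ram_of_lowerOverC [W.IsGloballyMinimal]
    (hGZ : ∀ (N : ℕ) [NeZero N] (W : WeierstrassCurve ℚ) (K : Type) [Field K] [NumberField K],
      gross_zagier N W K)
    (hKo : ∀ (N : ℕ) [NeZero N] (W : WeierstrassCurve ℚ) (K : Type) [Field K] [NumberField K],
      kolyvagin N W K)
    (hB : ∀ (N : ℕ) [NeZero N] (W : WeierstrassCurve ℚ) (K : Type) [Field K] [NumberField K],
      Kolyvagin1990_padicValNat_card_sha_le N W K)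
    (hGZK : rank_eq_analyticRank_of_analyticRank_le_one) (hmod : hasEntireLFunction_rat)
    (hnf : exists_isNewformOf) (hFH : friedbergHoffstein_exists_heegnerField_split_twist_ne_zero)
    (hMilneC : Milne1972.bsdQuotient_baseChange_quadratic_anyModel)
    (hSk : Skinner2016.thmC_padicValRat_bsd_rank_zero)
    (hHL : HoffsteinLuo1997_exists_twist_L_one_ne_zero)
    [NeZero (W.conductorNorm ℤ)]
    (hX : ClassX4M W p) (hr : W.analyticRank = 1) (hram : Ram W p) (hp5 : 5 ≤ p)
    (D : ModularParametrizationData W (W.conductorNorm ℤ)) (hc : ¬ (p : ℤ) ∣ D.c)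
    (htam : ¬ p ∣ W.tamagawaProduct)
    (hlowK : ∀ (V : WeierstrassCurve ℚ) [V.IsElliptic] [V.IsGloballyMinimal], ClassX4M V p →
      V.j = W.j → V.analyticRank = 0 →
      ∀ (K : Type) [Field K] [NumberField K] (Vd : WeierstrassCurve ℚ) [Vd.IsElliptic]
        [Vd.IsGloballyMinimal], Module.finrank ℚ K = 2 →
        (∃ C : VariableChange ℚ, C • V.quadraticTwist (NumberField.discr K : ℚ) = Vd) →
        Mult Vd p → MissingLowerBoundOverCAt (V.baseChange K) p) :
    MissingUpperBoundAt W p := by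
  obtain ⟨q, hq, hqp, hjq, hpj⟩ := exists_jWitness_of_ram (W := W) (p := p) hram
  exact missingUpperBoundAt_of_classX4M_rankOne_of_jWitness_of_lowerOverC hGZ hKo hB hGZK hmod hnf hFH
    hMilneC hSk hHL hX hr (surj_of_irr_of_ram W p hX.irr hram) hp5 hq hqp hjq hpj D hc htam hlowK

/-- **… and `BSD(E,p)` there from LOWER-bound statements alone**: the same, plus the lower half
`MissingLowerBoundAt W p` of the rank-one pair itself. [cite: Miller2011LMS, Def. 1.1] -/
theorem bsdp_of_classX4M_rankOne_of_jWitness_of_lower_of_lowerOverC [W.IsGloballyMinimal]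
    (hGZ : ∀ (N : ℕ) [NeZero N] (W : WeierstrassCurve ℚ) (K : Type) [Field K] [NumberField K],
      gross_zagier N W K)
    (hKo : ∀ (N : ℕ) [NeZero N] (W : WeierstrassCurve ℚ) (K : Type) [Field K] [NumberField K],
      kolyvagin N W K)
    (hB : ∀ (N : ℕ) [NeZero N] (W : WeierstrassCurve ℚ) (K : Type) [Field K] [NumberField K],
      Kolyvagin1990_padicValNat_card_sha_le N W K)
    (hGZK : rank_eq_analyticRank_of_analyticRank_le_one) (hmod : hasEntireLFunction_rat)
    (hnf : exists_isNewformOf) (hFH : friedbergHoffstein_exists_heegnerField_split_twist_ne_zero)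
    (hMilneC : Milne1972.bsdQuotient_baseChange_quadratic_anyModel)
    (hSk : Skinner2016.thmC_padicValRat_bsd_rank_zero)
    (hHL : HoffsteinLuo1997_exists_twist_L_one_ne_zero)
    [NeZero (W.conductorNorm ℤ)]
    (hX : ClassX4M W p) (hr : W.analyticRank = 1) (hsurj : Surj W p) (hp5 : 5 ≤ p)
    {q : ℕ} (hq : q.Prime) (hqp : q ≠ p) (hjq : padicValRat q W.j < 0)
    (hpj : ¬ (p : ℤ) ∣ padicValRat q W.j)
    (D : ModularParametrizationData W (W.conductorNorm ℤ)) (hc : ¬ (p : ℤ) ∣ D.c)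
    (htam : ¬ p ∣ W.tamagawaProduct) (hlowW : MissingLowerBoundAt W p)
    (hlowK : ∀ (V : WeierstrassCurve ℚ) [V.IsElliptic] [V.IsGloballyMinimal], ClassX4M V p →
      V.j = W.j → V.analyticRank = 0 →
      ∀ (K : Type) [Field K] [NumberField K] (Vd : WeierstrassCurve ℚ) [Vd.IsElliptic]
        [Vd.IsGloballyMinimal], Module.finrank ℚ K = 2 →
        (∃ C : VariableChange ℚ, C • V.quadraticTwist (NumberField.discr K : ℚ) = Vd) →
        Mult Vd p → MissingLowerBoundOverCAt (V.baseChange K) p) :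
    BSDp W p :=
  bsdp_of_missingPPartAt W p hGZK (by rw [hr])
    (missingPPartAt_of_lower_of_upper W p hlowW
      (missingUpperBoundAt_of_classX4M_rankOne_of_jWitness_of_lowerOverC hGZ hKo hB hGZK hmod hnf
        hFH hMilneC hSk hHL hX hr hsurj hp5 hq hqp hjq hpj D hc htam hlowK))

end Summit.BirchSwinnertonDyer.Rank1Residual.AdditivePotMult

end
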